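import Summits.Schanuel.Schanuel.Theorems.ZilberEacRealLineLevel
import Summits.Schanuel.Schanuel.Theorems.ZilberEacRealLineCore
import HarnessLib

/-!
# Real irrational slopes: the last open row of the line family of Mantova–Masser's density question

Zilber's Exponential-Algebraic Closedness, case ladder (host summit Schanuel, cell `pub-schanuel`,
seat 2, gen 7).  Third of three files (main theorems).

**HONEST FRAMING.** A modest, kernel-checked instance class of an OPEN QUESTION (Mantova–Masser,
Proc. LMS 2024, §1 p. 5: are the unprojected exponential points of a surface of case
(dim-π-S-1-free) Zariski dense — "unclear, even for `n = 2`").  Nothing here bears on Schanuel's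
conjecture (EAC ⇏ SC); the rung `ECCell 3 2` and all its typed pieces stay OPEN.

## The theorem

For a REAL IRRATIONAL slope `a`, any `b ∈ ℂ` and ANY nonzero fibre polynomial `q ∈ ℂ[y]`, the line
surface `S = {x₁ = a x₀ + b, y₀ = q(y₁)} ⊆ ℂ² × ℂ²` has Zariski dense exponential points
(`unprojectedDense_line_of_irrational`): the solutions `z` of `e^{z} = q(e^{a z + b})` together with
`w = e^{a z + b}` are Zariski dense in `S`.  With `EACDensityLineTwist` (non-real slopes; monomial
fibres) and `EACDensityTransport` (`S` is in the case iff `a ∉ ℚ`) this DECIDES THE WHOLE LINE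
FAMILY:
`MMCaseDimPiOneFree S → UnprojectedDense S` for every `a, b ∈ ℂ`, `q ≠ 0`
(`mmDensity_line`, `unprojectedDense_line_of_forall_rat_ne`), and the aligned lines
`{x₁ = a x₀ + b, y₁ = q(y₀)}` by the index swap (`mmDensity_alignedLine`).  The row
"`a ∈ ℝ \ ℚ`, `q` not a monomial" was the one left OPEN in `EACDensityLineTwist` ("no degenerating
regime"); even the existence of one exponential point on it was not in the tree
(`exists_exp_eq_eval_exp_of_irrational`; in print existence follows from Gallinaro, Selecta Math. 29
(2023) Thm 8.8, or Mantova–Masser Thm 1.2).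

## The method (new engine: a harmonic level set, the open mapping theorem, and Kronecker density)

No escape, growth or rotation regime exists for real slopes: all zeros of `e^{z} - q(e^{az+b})`
lie in a
vertical strip.  Instead:
1. (`exists_levelPoint`) there is `u₀ ≠ 0` with `q(u₀) ≠ 0` on the level set
   `log |u| = a log |q(u)| + Re b` — an intermediate-value argument along the segment from `0` to a
   root of `q` of minimal modulus (`a > 0`) or along the ray beyond a root of maximal modulus
   (`a < 0`), after the fibre twist of `EACDensityLineTwist` has made `q(0) ≠ 0`;
2. (`realLine_core`) near `u₀` the holomorphic function `L(u) = log u - a log q(u) - b` (local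
   branches) is not locally constant (`a ∉ ℚ`: otherwise `q = a·y·q'`,
   `eq_zero_of_forall_deriv_rel`),
   so by the OPEN MAPPING THEOREM (Mathlib `AnalyticAt.eventually_constant_or_nhds_le_map_nhds`) it
   attains, near every point of its purely imaginary level set, every value `2πi(m + a k)` with
   `m + a k` close to the target and `|k|` as large as desired (`exists_int_int_near_of_irrational`,
   Dirichlet/Kronecker); a point `u` with `L(u) = 2πi(m + a k)` IS an exponential point:
   `z = log q(u) + 2πik`, `w = u`, `e^{z} = q(w)`, `e^{a z + b} = w`;
3. hence the fibre coordinates `w` of exponential points accumulate at every point of an arc (an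
   infinite set), while `|z| → ∞` along each such sequence; a polynomial vanishing on the
   exponential
   points then has a leading `z`-coefficient vanishing on the arc
   (`EACDensityOscillatory.tendsto_norm_leadingCoeff_eval`), so it vanishes on `S`
   (`unprojectedDense_graphPolySurface_of_accumulation`).
This is the "torus companion" philosophy of Avellar–Hale (J. Math. Anal. Appl. 73 (1980)) for zeros
of exponential polynomials with real frequencies, pushed to the Zariski-density statement.

All statements are over Mathlib + the cited tree files; no published theorem is used as a
hypothesis.  Companion files: `ZilberEacRealLineLevel` (accumulation criterion, level points),
`ZilberEacRealLineCore` (Kronecker lemma, the analytic core).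
-/

noncomputable section

open MvPolynomial Filter Topology Complex Metric
open Literature.NumberTheory.Transcendental Literature.ModelTheory.Zilber
  Literature.ModelTheory.ExponentialFields

set_option linter.dupNamespace false

namespace Summit.Schanuel.Schanuel.Theorems

/-! ## Part E. The theorems -/

section Main

/-- An irrational real, viewed in `ℂ`, is not (the image of) a rational. -/
theorem forall_rat_ne_of_irrational {a : ℝ} (ha : Irrational a) : ∀ r : ℚ, (a : ℂ) ≠ (r : ℂ) := by
  intro r h
  apply ha
  refine ⟨r, ?_⟩
  have h1 : ((r : ℝ) : ℂ) = (a : ℂ) := by rw [h]; push_cast; rfl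
  exact_mod_cast h1

/-- The tilted slope `a / (1 - m a)` of the fibre twist is again irrational. -/
theorem irrational_div_one_sub_nat_mul {a : ℝ} (ha : Irrational a) (m : ℕ) :
    Irrational (a / (1 - m * a)) := by
  have hl : (1 : ℝ) - m * a ≠ 0 := by
    intro h
    rcases Nat.eq_zero_or_pos m with hm | hm
    · simp [hm] at h
    · apply ha.ne_rational 1 m
      have hm' : (m : ℝ) ≠ 0 := by exact_mod_cast hm.ne'
      rw [eq_div_iff (by exact_mod_cast hm')]
      push_cast
      linarith
  rintro ⟨r, hr⟩
  have e : a = r * (1 - m * a) := by rw [← div_eq_iff hl, ← hr]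
  have h1 : (1 : ℝ) + m * r ≠ 0 := by
    intro h0
    have hr0 : (r : ℝ) = 0 := by linear_combination (-1 : ℝ) * e + a * h0
    apply ha
    exact ⟨0, by rw [Rat.cast_zero, e, hr0, zero_mul]⟩
  apply ha
  refine ⟨r / (1 + m * r), ?_⟩
  push_cast
  rw [div_eq_iff h1]
  linear_combination (-1 : ℝ) * e

/-- **Real irrational slope, `q(0) ≠ 0`.** The exponential points of `{x₁ = a x₀ + b, y₀ = q(y₁)}`
are Zariski dense (`a ∈ ℝ \ ℚ`, `q(0) ≠ 0`): level point + analytic core + accumulation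
criterion. -/
theorem unprojectedDense_line_of_irrational_of_eval_ne {a : ℝ} (ha : Irrational a) (b : ℂ)
    {q : Polynomial ℂ} (hq0 : q.eval 0 ≠ 0) :
    UnprojectedDense (graphPolySurface (linePoly (a : ℂ) b) q) := by
  obtain ⟨u₀, hu₀, hqu₀, hlev⟩ := exists_levelPoint ha b hq0
  obtain ⟨A, hA, hAcc⟩ := realLine_core ha b hu₀ hqu₀ hlev
  refine unprojectedDense_graphPolySurface_of_accumulation _ q hA fun α hα => ?_
  obtain ⟨z, w, hz, hw, hzw⟩ := hAcc α hα
  exact ⟨z, w, hz, hw, fun k => ⟨(hzw k).1, by rw [eval_linePoly]; exact (hzw k).2⟩⟩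

/-- **THEOREM (real irrational slopes, all fibres).** For `a ∈ ℝ \ ℚ`, `b ∈ ℂ` and every `q ≠ 0`
the exponential points of the line surface `{x₁ = a x₀ + b, y₀ = q(y₁)}` — the solutions of
`e^{z} = q(e^{a z + b})` — are Zariski dense.  (The order of `q` at `0` is removed by the fibre
twist
`EACDensityLineTwist.unprojectedDense_lineSurface_pow_mul_iff`, which tilts the slope to the again
irrational `a/(1 - m a)`.) -/
theorem unprojectedDense_line_of_irrational {a : ℝ} (ha : Irrational a) (b : ℂ)
    {q : Polynomial ℂ} (hq : q ≠ 0) :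
    UnprojectedDense (graphPolySurface (linePoly (a : ℂ) b) q) := by
  classical
  obtain ⟨q₁, hfac, hndvd⟩ := Polynomial.exists_eq_pow_rootMultiplicity_mul_and_not_dvd q hq 0
  rw [map_zero, sub_zero] at hfac hndvd
  set m := Polynomial.rootMultiplicity 0 q
  have hq₁0 : q₁.eval 0 ≠ 0 := by
    rwa [← Polynomial.coeff_zero_eq_eval_zero, ne_eq, ← Polynomial.X_dvd_iff]
  have hq₁ : q₁ ≠ 0 := by
    rintro rfl
    exact hq₁0 Polynomial.eval_zero
  have hl : (1 : ℂ) - m * (a : ℂ) ≠ 0 :=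
    one_sub_natCast_mul_ne_zero_of_forall_rat_ne (forall_rat_ne_of_irrational ha) m
  rw [hfac, unprojectedDense_lineSurface_pow_mul_iff (a : ℂ) b m hq₁ hl]
  have hcast : (a : ℂ) / (1 - m * (a : ℂ)) = ((a / (1 - m * a) : ℝ) : ℂ) := by push_cast; rfl
  rw [hcast]
  exact unprojectedDense_line_of_irrational_of_eval_ne (irrational_div_one_sub_nat_mul ha m) _ hq₁0

/-- **THEOREM (every irrational slope, real or not).** For `a ∈ ℂ \ ℚ`, `b ∈ ℂ`, `q ≠ 0` the
exponential points of `{x₁ = a x₀ + b, y₀ = q(y₁)}` are Zariski dense — non-real slopes by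
`EACDensityLineTwist.unprojectedDense_lineSurface_of_ne_zero`, real irrational slopes by this
file. -/
theorem unprojectedDense_line_of_forall_rat_ne (a b : ℂ) (ha : ∀ r : ℚ, a ≠ (r : ℂ))
    {q : Polynomial ℂ} (hq : q ≠ 0) :
    UnprojectedDense (graphPolySurface (linePoly a b) q) := by
  by_cases him : a.im = 0
  · have hre : a = ((a.re : ℝ) : ℂ) := by
      apply Complex.ext <;> simp [him]
    have hirr : Irrational a.re := by
      rintro ⟨r, hr⟩
      apply ha r
      rw [hre, ← hr]
      push_cast
      rfl
    rw [hre]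
    exact unprojectedDense_line_of_irrational hirr b hq
  · exact unprojectedDense_lineSurface_of_ne_zero b him hq

/-- **Mantova–Masser's typed density question HOLDS ON THE ENTIRE LINE FAMILY**: for every
`a, b ∈ ℂ` and `q ≠ 0`, if `{x₁ = a x₀ + b, y₀ = q(y₁)}` is in the case (dim-π-S-1-free) — which
happens iff `a ∉ ℚ`, `EACDensityTransport.mmCase_graphPolySurface_line_iff` — then its exponential
points are Zariski dense. -/
theorem mmDensity_line (a b : ℂ) {q : Polynomial ℂ} (hq : q ≠ 0) :
    MMCaseDimPiOneFree (graphPolySurface (linePoly a b) q) →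
      UnprojectedDense (graphPolySurface (linePoly a b) q) := fun h =>
  unprojectedDense_line_of_forall_rat_ne a b ((mmCase_graphPolySurface_line_iff a b hq).1 h) hq

/-- **Case ∧ density for every line surface of irrational slope** (`a ∉ ℚ`, `q ≠ 0`). -/
theorem unprojectedDensityQuestion_instance_line_of_forall_rat_ne {a : ℂ} (b : ℂ)
    (ha : ∀ r : ℚ, a ≠ (r : ℂ)) {q : Polynomial ℂ} (hq : q ≠ 0) :
    MMCaseDimPiOneFree (graphPolySurface (linePoly a b) q) ∧
      UnprojectedDense (graphPolySurface (linePoly a b) q) :=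
  ⟨mmCase_graphPolySurface_line ha hq, unprojectedDense_line_of_forall_rat_ne a b ha hq⟩

/-- On the line family, "in the case" and "dense" COINCIDE for `q ≠ 0` whenever `a ∉ ℚ`; this is the
iff form: in the case `↔ a ∉ ℚ`, and then dense. -/
theorem mmCase_line_iff_and_dense (a b : ℂ) {q : Polynomial ℂ} (hq : q ≠ 0) :
    MMCaseDimPiOneFree (graphPolySurface (linePoly a b) q) ↔
      (∀ r : ℚ, a ≠ (r : ℂ)) ∧ UnprojectedDense (graphPolySurface (linePoly a b) q) := by
  rw [mmCase_graphPolySurface_line_iff a b hq]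
  exact ⟨fun h => ⟨h, unprojectedDense_line_of_forall_rat_ne a b h hq⟩, fun h => h.1⟩

/-- **Aligned lines** `{x₁ = a x₀ + b, y₁ = q(y₀)}` (`a ∉ ℚ`, `q ≠ 0`): Zariski dense exponential
points, by the index swap `EACDensityLineTwist.alignedSurface_line_eq_indexSwapped`. -/
theorem unprojectedDense_alignedLine_of_forall_rat_ne {a : ℂ} (b : ℂ) (ha : ∀ r : ℚ, a ≠ (r : ℂ))
    {q : Polynomial ℂ} (hq : q ≠ 0) : UnprojectedDense (alignedSurface (linePoly a b) q) := by
  have ha0 : a ≠ 0 := fun h => ha 0 (by rw [h, Rat.cast_zero])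
  rw [alignedSurface_line_eq_indexSwapped ha0, unprojectedDense_indexSwapped_iff]
  exact unprojectedDense_line_of_forall_rat_ne _ _ ((forall_rat_ne_inv_iff a).2 ha) hq

/-- **Case ∧ density for every aligned line surface of irrational slope** (`a ∉ ℚ`, `q ≠ 0`); with
`EACDensityAligned` (base of degree `≥ 2`) the aligned family `{x₁ = r(x₀), y₁ = q(y₀)}` is now
decided
for every `r` that puts it in the case. -/
theorem unprojectedDensityQuestion_instance_alignedLine {a : ℂ} (b : ℂ)
    (ha : ∀ r : ℚ, a ≠ (r : ℂ)) {q : Polynomial ℂ} (hq : q ≠ 0) :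
    MMCaseDimPiOneFree (alignedSurface (linePoly a b) q) ∧
      UnprojectedDense (alignedSurface (linePoly a b) q) :=
  ⟨mmCase_alignedSurface_line b ha hq, unprojectedDense_alignedLine_of_forall_rat_ne b ha hq⟩

/-- Density forces existence: a non-empty `W` with `I(W ∩ Γ_exp) = I(W)` meets `Γ_exp`. -/
theorem inter_expGraph_nonempty_of_unprojectedDense_of_nonempty {n : ℕ}
    {W : Set (Fin n ⊕ Fin n → ℂ)} (hW : W.Nonempty) (h : UnprojectedDense W) :
    (W ∩ expGraph ℂ n).Nonempty := by
  by_contra hne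
  rw [Set.not_nonempty_iff_eq_empty] at hne
  obtain ⟨x, hx⟩ := hW
  have h1 : (1 : MvPolynomial (Fin n ⊕ Fin n) ℂ) ∈ vanishingIdeal ℂ W := by
    rw [← h, hne, vanishingIdeal_empty]
    exact Submodule.mem_top
  have h2 := (mem_vanishingIdeal_iff.1 h1) x hx
  rw [map_one] at h2
  exact one_ne_zero h2

/-- **Existence of exponential points on every line surface of irrational slope**: for `a ∉ ℚ`
(in particular every REAL irrational `a`), `b ∈ ℂ`, `q ≠ 0` the equation `e^{z} = q(e^{a z + b})`
has
a solution.  (In print: Gallinaro 2023 Thm 8.8 / Mantova–Masser 2024 Thm 1.2; here a corollary of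
density, first time in the tree for real slopes with non-monomial `q`.) -/
theorem exists_exp_eq_eval_exp_of_forall_rat_ne {a : ℂ} (b : ℂ) (ha : ∀ r : ℚ, a ≠ (r : ℂ))
    {q : Polynomial ℂ} (hq : q ≠ 0) : ∃ z : ℂ, exp z = q.eval (exp (a * z + b)) := by
  obtain ⟨s, hs, hsΓ⟩ := inter_expGraph_nonempty_of_unprojectedDense_of_nonempty
    ((graphPolySurface_inter_torusLocus_nonempty (linePoly a b) hq).mono Set.inter_subset_left)
    (unprojectedDense_line_of_forall_rat_ne a b ha hq)
  rw [mem_graphPolySurface_iff, eval_linePoly] at hs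
  rw [mem_expGraph_iff] at hsΓ
  refine ⟨s (Sum.inl 0), ?_⟩
  have h0 := hsΓ 0
  have h1 := hsΓ 1
  simp only [ExponentialRing.complex_exp_eq] at h0 h1
  rw [← h0, hs.2, ← hs.1, h1]

/-- **Real irrational slopes**: `e^{z} = q(e^{a z + b})` is solvable for every `a ∈ ℝ \ ℚ`, `b ∈ ℂ`,
`q ≠ 0`. -/
theorem exists_exp_eq_eval_exp_of_irrational {a : ℝ} (ha : Irrational a) (b : ℂ)
    {q : Polynomial ℂ} (hq : q ≠ 0) : ∃ z : ℂ, exp z = q.eval (exp ((a : ℂ) * z + b)) :=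
  exists_exp_eq_eval_exp_of_forall_rat_ne b (forall_rat_ne_of_irrational ha) hq

/-- Example (the model equation of the formerly open row): the exponential points of
`{x₁ = √2 x₀, y₀ = y₁ + 1}` — the solutions of `e^{z} = e^{√2 z} + 1` — are Zariski dense. -/
example : UnprojectedDense (graphPolySurface (linePoly (Real.sqrt 2 : ℂ) 0)
    (Polynomial.X + Polynomial.C 1)) :=
  unprojectedDense_line_of_irrational irrational_sqrt_two 0 (by
    intro h
    have := congrArg (Polynomial.eval (0 : ℂ)) h
    norm_num at this)

/-- Example: `e^{z} = e^{√2 z} + 1` has a solution `z ∈ ℂ`. -/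
example : ∃ z : ℂ, exp z = exp ((Real.sqrt 2 : ℂ) * z) + 1 := by
  obtain ⟨z, hz⟩ := exists_exp_eq_eval_exp_of_irrational irrational_sqrt_two 0
    (q := Polynomial.X + Polynomial.C 1) (by
      intro h
      have := congrArg (Polynomial.eval (0 : ℂ)) h
      norm_num at this)
  exact ⟨z, by simpa using hz⟩

end Main

end Summit.Schanuel.Schanuel.Theorems

end
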